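import Literature.Analysis.FluidPDE.OseenKernelComplexBounds
import Literature.Analysis.FluidPDE.NSBoundedMildOseenDuhamel
import HarnessLib

/-!
# The complexified Oseen scheme: domain, operators, and the `L^∞` estimates

Analysis/FluidPDE definitions file, third layer (W3a) of the proof of the named fact
`Literature.Analysis.FluidPDE.lemarieRieusset2016_local_analyticity` (`NSBoundedMildAnalytic.lean`;
Lemarié-Rieusset 2016, Thm. 9.12, proof pp. 260–263). With the complexified kernels of
`OseenKernelComplex.lean` (root time `m`, `m² = νt`) and their sector bounds
(`OseenKernelComplexBounds.lean`) this file sets up **Oseen's scheme with complex time and a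
complex Galilean parameter**:

* the parameter domain `schemeDomain ν T₀ ⊆ ℂ × ℂ^ι` of pairs `p = (m, g)` — root times in the
  open sector `0 < Re m`, `|Im m| < Re m/2` with `‖m‖² < νT₀`, and Galilean parameters
  `‖g‖ < (νT₀)^{-1/2}` (so that every complex shift `m²g` occurring below is admissible,
  `‖m² g‖ ≤ ‖m‖`); it is open and star-shaped under `m ↦ √θ m`;
* the **free term** `freeTermC b p x = ∫ 𝒢(m, y - m²g) b(x - y) dy` — for real `m = √(νt)` and
  real `g` this is `e^{νtΔ}b (x - νt g)`, the Galilean transform of the caloric extension;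
* the **bilinear term**
  `duhamelC ν V W p x = ν⁻¹ ∫₀¹ m² ∫ 𝒦(√(1-θ) m, y - (1-θ)m²g)[V(√θ m, g)(x-y), W(√θ m, g)(x-y)] dy dθ`
  — the Duhamel term `∫₀ᵗ e^{ν(t-σ)Δ}ℙ∇·(V ⊗ W)(σ) dσ` written in root time (`σ = θt`,
  `ν(t-σ) = (1-θ)m²`, `dσ = ν⁻¹m² dθ`) with the Galilean shifts, as an iterated integral like the
  tree's `oseenDuhamel`;
* the class `IsSchemeField ν T₀ K V` of fields `V : ℂ × ℂ^ι → ℝ^ι → ℂ^ι` that are jointly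
  continuous on `schemeDomain × ℝ^ι`, bounded by `K` there, and holomorphic in `p` for every `x`;
* the **`L^∞` estimates of Oseen's scheme** (Lemarié-Rieusset 2016, p. 262:
  `‖V₀‖_{L^∞(t₀+Ω_γ)} ≤ C_γ‖u(t₀)‖_∞`; p. 263: the bilinear estimate on the cone with the factor
  `√(Re τ - t₀)`): `‖freeTermC b p x‖ ≤ C_G M` and
  `‖duhamelC ν V W p x‖ ≤ 3 C_K √(νT₀)/ν · K_V K_W` on the domain (`norm_freeTermC_le`,
  `exists_norm_duhamelC_le`), by the `L¹` kernel bounds and `∫₀¹ (1-θ)^{-1/2} dθ = 2`;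
* algebra: additivity of the complexified kernel in its tensor slots
  (`oseenKernelC_add_left/right`, `oseenKernelC_sub_left/right`), for the splitting
  `𝓑(V,V) - 𝓑(W,W) = 𝓑(V-W, V) + 𝓑(W, V-W)` of the contraction step.

Holomorphy and joint continuity of `freeTermC`, `duhamelC` (closure of `IsSchemeField` under the
scheme, integrability and the splitting) are the next layer (W3b); the iteration and the real
restriction follow (W4).

## Mathlib / tree search

Tree: W1/W2 (`heatKernelC`, `oseenKernelC`, `exists_lintegral_oseenKernelC_shift_le`,
`lintegral_heatKernelC_shift_le`, `norm_le_of_sector`), `setLIntegral_Ioo_sub_rpow_neg_half_of_lt`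
(`NSBoundedMildOseenDuhamel.lean`), `oseenDuhamel` (the real model, `NSBoundedMildOseen.lean`).
Mathlib: `enorm_integral_le_lintegral_enorm`, `lintegral_const_mul'`, `Real.sqrt_lt'`,
`Complex.re_ofReal_mul`, `isOpen_lt`.

## References

* P. G. Lemarié-Rieusset, *The Navier–Stokes Problem in the 21st Century*, CRC Press 2016,
  Thm. 9.12, proof pp. 260–263 (`V₀(τ,z)`, `V_{k+1}(τ,z)` on `t₀ + Ω_γ`, and their `L^∞` bounds);
  Thm. 5.1, pp. 103–105 (Oseen's scheme). [LemarieRieusset2016]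
-/

noncomputable section

open MeasureTheory Set Filter Metric Real
open _root_.Topology
open scoped BigOperators ENNReal

namespace Literature.Analysis.FluidPDE

open Literature.Analysis.FunctionSpaces.EuclideanSpace (complexify complexify_apply norm_complexify)
open UnboundedOperators (heatKernel)

variable {ι : Type*} [Fintype ι]

/-! ### The parameter domain -/

/-- **The parameter domain of the complexified Oseen scheme**: pairs `(m, g)` of a root time `m`
in the open sector `0 < Re m`, `|Im m| < Re m / 2` with `‖m‖² < νT₀` (i.e. complex times
`t = m²/ν` in a sector over `(0, T₀)`), and a complex Galilean parameter `g` with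
`‖g‖ < (νT₀)^{-1/2}` (Lemarié-Rieusset 2016, proof of Thm. 9.12, p. 261: the cone
`Ω_{γ,M} = {0 < Re τ, |Im τ| < γ Re τ, |Re τ - t₀| < M}`; the Galilean parameter replaces the
complex space variable of the printed cone). [cite: LemarieRieusset2016, Thm. 9.12 (proof, p. 261)] -/
def schemeDomain (ν T₀ : ℝ) : Set (ℂ × EuclideanSpace ℂ ι) :=
  {p | 0 < p.1.re ∧ |p.1.im| < p.1.re / 2 ∧ ‖p.1‖ ^ 2 < ν * T₀ ∧ ‖p.2‖ < (Real.sqrt (ν * T₀))⁻¹}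

/-- Membership in the parameter domain, unfolded. [folklore] -/
theorem mem_schemeDomain {ν T₀ : ℝ} {p : ℂ × EuclideanSpace ℂ ι} :
    p ∈ schemeDomain ν T₀ ↔
      0 < p.1.re ∧ |p.1.im| < p.1.re / 2 ∧ ‖p.1‖ ^ 2 < ν * T₀ ∧ ‖p.2‖ < (Real.sqrt (ν * T₀))⁻¹ :=
  Iff.rfl

/-- The parameter domain is open. [folklore] -/
theorem isOpen_schemeDomain (ν T₀ : ℝ) : IsOpen (schemeDomain (ι := ι) ν T₀) := by
  have h1 : IsOpen {p : ℂ × EuclideanSpace ℂ ι | 0 < p.1.re} :=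
    isOpen_lt continuous_const (Complex.continuous_re.comp continuous_fst)
  have h2 : IsOpen {p : ℂ × EuclideanSpace ℂ ι | |p.1.im| < p.1.re / 2} :=
    isOpen_lt (continuous_abs.comp (Complex.continuous_im.comp continuous_fst))
      ((Complex.continuous_re.comp continuous_fst).div_const _)
  have h3 : IsOpen {p : ℂ × EuclideanSpace ℂ ι | ‖p.1‖ ^ 2 < ν * T₀} :=
    isOpen_lt ((continuous_norm.comp continuous_fst).pow 2) continuous_const
  have h4 : IsOpen {p : ℂ × EuclideanSpace ℂ ι | ‖p.2‖ < (Real.sqrt (ν * T₀))⁻¹} :=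
    isOpen_lt (continuous_norm.comp continuous_snd) continuous_const
  have : schemeDomain (ι := ι) ν T₀ =
      {p | 0 < p.1.re} ∩ {p | |p.1.im| < p.1.re / 2} ∩ {p | ‖p.1‖ ^ 2 < ν * T₀} ∩
        {p | ‖p.2‖ < (Real.sqrt (ν * T₀))⁻¹} := by
    ext p; simp only [schemeDomain, mem_setOf_eq, mem_inter_iff, and_assoc]
  rw [this]
  exact ((h1.inter h2).inter h3).inter h4

/-- Real points of the domain: for `0 < t < T₀`, `ν > 0`, the pair `(√(νt), 0)` lies in
`schemeDomain ν T₀`. [folklore] -/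
theorem sqrt_mem_schemeDomain {ν T₀ t : ℝ} (hν : 0 < ν) (ht : 0 < t) (htT : t < T₀) :
    ((((Real.sqrt (ν * t) : ℝ) : ℂ), (0 : EuclideanSpace ℂ ι)) : ℂ × EuclideanSpace ℂ ι) ∈
      schemeDomain ν T₀ := by
  have hνt : 0 < ν * t := mul_pos hν ht
  have hνT : 0 < ν * T₀ := mul_pos hν (ht.trans htT)
  refine ⟨?_, ?_, ?_, ?_⟩
  · simpa using Real.sqrt_pos.2 hνt
  · simp only [Complex.ofReal_im, abs_zero, Complex.ofReal_re]
    exact div_pos (Real.sqrt_pos.2 hνt) two_pos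
  · rw [Complex.norm_real, Real.norm_of_nonneg (Real.sqrt_nonneg _), Real.sq_sqrt hνt.le]
    exact mul_lt_mul_of_pos_left htT hν
  · simpa using inv_pos.2 (Real.sqrt_pos.2 hνT)

section Admissible

variable {ν T₀ : ℝ} {m : ℂ} {g : EuclideanSpace ℂ ι}

/-- On the domain, `νT₀ > 0`. [folklore] -/
theorem schemeDomain_pos (hp : (m, g) ∈ schemeDomain (ι := ι) ν T₀) : 0 < ν * T₀ :=
  (sq_nonneg _).trans_lt hp.2.2.1

/-- **The basic shift is admissible**: `‖m² g‖ ≤ ‖m‖` on the domain (indeed `‖m‖ ‖g‖ < 1`).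
[folklore] -/
theorem norm_sq_smul_le (hp : (m, g) ∈ schemeDomain (ι := ι) ν T₀) : ‖(m ^ 2) • g‖ ≤ ‖m‖ := by
  obtain ⟨-, -, hm2, hg⟩ := hp
  have hνT : 0 < ν * T₀ := (sq_nonneg _).trans_lt hm2
  have hs : 0 < Real.sqrt (ν * T₀) := Real.sqrt_pos.2 hνT
  have hm : ‖m‖ < Real.sqrt (ν * T₀) := by
    rw [← Real.sqrt_sq (norm_nonneg m)]; exact Real.sqrt_lt_sqrt (sq_nonneg _) hm2
  have hmg : ‖m‖ * ‖g‖ ≤ 1 := by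
    calc ‖m‖ * ‖g‖ ≤ Real.sqrt (ν * T₀) * (Real.sqrt (ν * T₀))⁻¹ :=
          mul_le_mul hm.le hg.le (norm_nonneg _) hs.le
      _ = 1 := mul_inv_cancel₀ hs.ne'
  rw [norm_smul, norm_pow]
  calc ‖m‖ ^ 2 * ‖g‖ = ‖m‖ * (‖m‖ * ‖g‖) := by ring
    _ ≤ ‖m‖ * 1 := by gcongr
    _ = ‖m‖ := mul_one _

/-- **The kernel root time `√(1-θ) m` stays in the closed sector** for `θ < 1`: positive real
part and `|Im| ≤ Re/2`. [folklore] -/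
theorem sector_sqrt_one_sub_mul (hp : (m, g) ∈ schemeDomain (ι := ι) ν T₀) {θ : ℝ} (hθ : θ < 1) :
    0 < (((Real.sqrt (1 - θ) : ℝ) : ℂ) * m).re ∧
      |(((Real.sqrt (1 - θ) : ℝ) : ℂ) * m).im| ≤ (((Real.sqrt (1 - θ) : ℝ) : ℂ) * m).re / 2 := by
  obtain ⟨hre, him, -, -⟩ := hp
  have hs : 0 < Real.sqrt (1 - θ) := Real.sqrt_pos.2 (by linarith)
  rw [Complex.re_ofReal_mul, Complex.im_ofReal_mul, abs_mul, abs_of_pos hs]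
  exact ⟨mul_pos hs hre, by nlinarith [him.le]⟩

/-- **The kernel shift `(1-θ)m² g` is admissible** against the kernel root time `√(1-θ) m`:
`‖(1-θ) m² g‖ ≤ ‖√(1-θ) m‖` for `0 ≤ θ < 1` on the domain. [folklore] -/
theorem norm_kernelShift_le (hp : (m, g) ∈ schemeDomain (ι := ι) ν T₀) {θ : ℝ} (hθ0 : 0 ≤ θ)
    (hθ : θ < 1) :
    ‖((((1 - θ : ℝ)) : ℂ) * m ^ 2) • g‖ ≤ ‖(((Real.sqrt (1 - θ) : ℝ) : ℂ) * m)‖ := by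
  have h1θ : 0 < 1 - θ := by linarith
  have hs : 0 < Real.sqrt (1 - θ) := Real.sqrt_pos.2 h1θ
  have hs1 : Real.sqrt (1 - θ) ≤ 1 := Real.sqrt_le_one.mpr (by linarith) |>.trans le_rfl
  have hbase := norm_sq_smul_le hp
  rw [norm_smul, norm_pow] at hbase
  rw [norm_smul, norm_mul, Complex.norm_real, Real.norm_of_nonneg h1θ.le, norm_pow, norm_mul,
    Complex.norm_real, Real.norm_of_nonneg hs.le]
  have hsq : (1 - θ) = Real.sqrt (1 - θ) * Real.sqrt (1 - θ) := (Real.mul_self_sqrt h1θ.le).symm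
  calc (1 - θ) * ‖m‖ ^ 2 * ‖g‖ = Real.sqrt (1 - θ) * Real.sqrt (1 - θ) * (‖m‖ ^ 2 * ‖g‖) := by
        rw [← hsq]; ring
    _ ≤ Real.sqrt (1 - θ) * 1 * ‖m‖ := by
        gcongr
    _ = Real.sqrt (1 - θ) * ‖m‖ := by ring

/-- **The field parameter `(√θ m, g)` stays in the domain** for `0 < θ ≤ 1` (the domain is
star-shaped in root time). [folklore] -/
theorem sqrt_mul_mem_schemeDomain (hp : (m, g) ∈ schemeDomain (ι := ι) ν T₀) {θ : ℝ}
    (hθ0 : 0 < θ) (hθ1 : θ ≤ 1) :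
    ((((Real.sqrt θ : ℝ) : ℂ) * m, g) : ℂ × EuclideanSpace ℂ ι) ∈ schemeDomain ν T₀ := by
  obtain ⟨hre, him, hm2, hg⟩ := hp
  have hs : 0 < Real.sqrt θ := Real.sqrt_pos.2 hθ0
  have hs1 : Real.sqrt θ ≤ 1 := Real.sqrt_le_one.mpr hθ1
  refine ⟨?_, ?_, ?_, hg⟩
  · rw [Complex.re_ofReal_mul]; exact mul_pos hs hre
  · rw [Complex.re_ofReal_mul, Complex.im_ofReal_mul, abs_mul, abs_of_pos hs]
    nlinarith
  · rw [norm_mul, Complex.norm_real, Real.norm_of_nonneg hs.le, mul_pow]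
    calc Real.sqrt θ ^ 2 * ‖m‖ ^ 2 ≤ 1 * ‖m‖ ^ 2 := by gcongr; nlinarith
      _ < ν * T₀ := by rw [one_mul]; exact hm2

/-- `‖m‖ ≤ (3/2) Re m` and `‖m‖ < √(νT₀)` on the domain. [folklore] -/
theorem norm_rootTime_le (hp : (m, g) ∈ schemeDomain (ι := ι) ν T₀) :
    ‖m‖ ≤ 3 / 2 * m.re ∧ ‖m‖ < Real.sqrt (ν * T₀) := by
  obtain ⟨hre, him, hm2, -⟩ := hp
  refine ⟨norm_le_of_sector hre him.le, ?_⟩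
  rw [← Real.sqrt_sq (norm_nonneg m)]; exact Real.sqrt_lt_sqrt (sq_nonneg _) hm2

end Admissible

/-! ### The operators of the complexified scheme -/

/-- **The free term of the complexified Oseen scheme**:
`freeTermC b (m, g) x = ∫ 𝒢(m, y - m²g) b(x - y) dy` with the complexified Gaussian
`𝒢 = heatKernelC` — for real `m = √(νt)` and real `g` this is `(e^{νtΔ}b)(x - νt g)`, the
Galilean transform of the caloric extension `V₀ = W_{ν(t-t₀)} ∗ u(t₀)` of Lemarié-Rieusset 2016,
proof of Thm. 9.12, p. 261 ("`V₀(τ,z) = ∫ W_{ν(τ-t₀)}(z-y) u(t₀,y) dy`"). The space variable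
enters only through the (real) datum, the complex parameters only through the kernel. [cite: LemarieRieusset2016, Thm. 9.12 (proof, p. 261)] -/
def freeTermC (b : EuclideanSpace ℝ ι → EuclideanSpace ℝ ι) (p : ℂ × EuclideanSpace ℂ ι)
    (x : EuclideanSpace ℝ ι) : EuclideanSpace ℂ ι :=
  ∫ y, heatKernelC p.1 (complexify y - (p.1 ^ 2) • p.2) • complexify (b (x - y))

/-- **The bilinear term of the complexified Oseen scheme**, in root time and as an iterated
integral (the complex continuation of the tree's `oseenDuhamel ν 0`, with `σ = θt`,
`ν(t-σ) = (1-θ)m²`, `dσ = ν⁻¹ m² dθ`, and the Galilean shifts):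
`duhamelC ν V W (m,g) x = ν⁻¹ ∫₀¹ m² ∫ 𝒦(√(1-θ)m, y - (1-θ)m²g)[V(√θm, g)(x-y), W(√θm, g)(x-y)] dy dθ`
(Lemarié-Rieusset 2016, proof of Thm. 9.12, p. 261: "`V_{k+1}(τ,z) = (-1)^{k+1} ∫_{t₀}^τ ∫
𝕆(ν(τ-t₀-σ), z-y) div(…) dσ dy`", here with `B(V,W) = ∫₀ᵗ W_{ν(t-s)} ∗ ℙ div(V ⊗ W) ds` of
p. 260). Bochner integrals; junk where they diverge (never on the class `IsSchemeField`). [cite: LemarieRieusset2016, Thm. 9.12 (proof, pp. 260–261)] -/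
def duhamelC (ν : ℝ) (V W : ℂ × EuclideanSpace ℂ ι → EuclideanSpace ℝ ι → EuclideanSpace ℂ ι)
    (p : ℂ × EuclideanSpace ℂ ι) (x : EuclideanSpace ℝ ι) : EuclideanSpace ℂ ι :=
  ((ν : ℂ))⁻¹ • ∫ θ in Ioo (0 : ℝ) 1, (p.1 ^ 2) •
    ∫ y, oseenKernelC ((Real.sqrt (1 - θ) : ℂ) * p.1)
      (complexify y - (((1 - θ : ℝ) : ℂ) * p.1 ^ 2) • p.2)
      (V ((Real.sqrt θ : ℂ) * p.1, p.2) (x - y)) (W ((Real.sqrt θ : ℂ) * p.1, p.2) (x - y))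

/-- **The class of fields of the complexified scheme** with bound `K` on `schemeDomain ν T₀`:
jointly continuous on `schemeDomain × ℝ^ι`, bounded by `K` there, and holomorphic in the
parameters `(m, g)` for every space point — the induction hypothesis "`V_k` is holomorphic on
`t₀ + Ω_γ` and bounded" of Lemarié-Rieusset 2016, proof of Thm. 9.12, pp. 262–263.
[cite: LemarieRieusset2016, Thm. 9.12 (proof, pp. 262–263)] -/
structure IsSchemeField (ν T₀ K : ℝ)
    (V : ℂ × EuclideanSpace ℂ ι → EuclideanSpace ℝ ι → EuclideanSpace ℂ ι) : Prop where
  /-- joint continuity in `(p, x)` on the domain -/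
  continuousOn : ContinuousOn (Function.uncurry V) (schemeDomain ν T₀ ×ˢ univ)
  /-- the uniform bound -/
  norm_le : ∀ p ∈ schemeDomain ν T₀, ∀ x, ‖V p x‖ ≤ K
  /-- holomorphy in the parameters -/
  differentiableOn : ∀ x, DifferentiableOn ℂ (fun p => V p x) (schemeDomain ν T₀)

/-- A field of the class has `K ≥ 0` as soon as the domain is non-empty (`ν, T₀ > 0`).
[folklore] -/
theorem IsSchemeField.nonneg {ν T₀ K : ℝ}
    {V : ℂ × EuclideanSpace ℂ ι → EuclideanSpace ℝ ι → EuclideanSpace ℂ ι}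
    (hV : IsSchemeField ν T₀ K V) (hν : 0 < ν) (hT₀ : 0 < T₀) : 0 ≤ K := by
  have hmem := sqrt_mem_schemeDomain (ι := ι) (t := T₀ / 2) hν (half_pos hT₀) (half_lt_self hT₀)
  exact (norm_nonneg _).trans (hV.norm_le _ hmem 0)

/-- The class is closed under subtraction, with the sum of the bounds. [folklore] -/
theorem IsSchemeField.sub {ν T₀ K K' : ℝ}
    {V W : ℂ × EuclideanSpace ℂ ι → EuclideanSpace ℝ ι → EuclideanSpace ℂ ι}
    (hV : IsSchemeField ν T₀ K V) (hW : IsSchemeField ν T₀ K' W) :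
    IsSchemeField ν T₀ (K + K') (fun p x => V p x - W p x) := by
  refine ⟨?_, fun p hp x => ?_, fun x => (hV.differentiableOn x).sub (hW.differentiableOn x)⟩
  · exact hV.continuousOn.sub hW.continuousOn
  · exact (norm_sub_le _ _).trans (add_le_add (hV.norm_le p hp x) (hW.norm_le p hp x))

/-- The class is monotone in the bound. [folklore] -/
theorem IsSchemeField.mono {ν T₀ K K' : ℝ}
    {V : ℂ × EuclideanSpace ℂ ι → EuclideanSpace ℝ ι → EuclideanSpace ℂ ι}
    (hV : IsSchemeField ν T₀ K V) (hKK' : K ≤ K') : IsSchemeField ν T₀ K' V :=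
  ⟨hV.continuousOn, fun p hp x => (hV.norm_le p hp x).trans hKK', hV.differentiableOn⟩

/-! ### The `L^∞` estimate of the free term -/

/-- **`L^∞` bound of the free term** (Lemarié-Rieusset 2016, proof of Thm. 9.12, p. 262:
"`‖V₀‖_{L^∞(t₀+Ω_γ)} ≤ C_γ ‖u(t₀,.)‖_∞`"): for a datum bounded by `M` pointwise and
`p ∈ schemeDomain ν T₀`, `‖freeTermC b p x‖ ≤ e² (25/6)^{d/2} M`. [cite: LemarieRieusset2016, Thm. 9.12 (proof, p. 262)] -/
theorem norm_freeTermC_le {ν T₀ M : ℝ} {b : EuclideanSpace ℝ ι → EuclideanSpace ℝ ι} (hM : 0 ≤ M)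
    (hb : ∀ y, ‖b y‖ ≤ M) {p : ℂ × EuclideanSpace ℂ ι} (hp : p ∈ schemeDomain ν T₀)
    (x : EuclideanSpace ℝ ι) :
    ‖freeTermC b p x‖ ≤ Real.exp 2 * (25 / 6 : ℝ) ^ ((Fintype.card ι : ℝ) / 2) * M := by
  obtain ⟨m, g⟩ := p
  have hre : 0 < m.re := hp.1
  have him : |m.im| < m.re / 2 := hp.2.1
  have hc : ‖(m ^ 2) • g‖ ≤ ‖m‖ := norm_sq_smul_le hp
  set K₀ : ℝ := Real.exp 2 * (25 / 6 : ℝ) ^ ((Fintype.card ι : ℝ) / 2) with hK₀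
  have hnn : 0 ≤ K₀ * M := by positivity
  rw [← ENNReal.ofReal_le_ofReal_iff hnn, ofReal_norm]
  unfold freeTermC
  calc ‖∫ y, heatKernelC m (complexify y - (m ^ 2) • g) • complexify (b (x - y))‖ₑ
      ≤ ∫⁻ y, ‖heatKernelC m (complexify y - (m ^ 2) • g) • complexify (b (x - y))‖ₑ :=
        enorm_integral_le_lintegral_enorm _
    _ = ∫⁻ y, ‖heatKernelC m (complexify (0 - (-y)) - (m ^ 2) • g)‖ₑ * ‖complexify (b (x + -y))‖ₑ := by
        refine lintegral_congr fun y => ?_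
        rw [enorm_smul, zero_sub, neg_neg, ← sub_eq_add_neg]
    _ = ∫⁻ y, ‖heatKernelC m (complexify (0 - y) - (m ^ 2) • g)‖ₑ * ‖complexify (b (x + y))‖ₑ :=
        lintegral_neg_eq_self
          (fun y => ‖heatKernelC m (complexify (0 - y) - (m ^ 2) • g)‖ₑ * ‖complexify (b (x + y))‖ₑ)
    _ ≤ ENNReal.ofReal (K₀ * M) :=
        lintegral_heatKernelC_shift_le hre him.le hc (F := fun y => complexify (b (x + y))) hM
          (fun y => by rw [norm_complexify]; exact hb _) 0

/-! ### The `L^∞` estimate of the bilinear term -/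

/-- `∫₀¹ (1-θ)^{-1/2} dθ = 2` as a set `∫⁻`. [folklore] -/
theorem setLIntegral_Ioo_one_sub_rpow_neg_half :
    ∫⁻ θ in Ioo (0 : ℝ) 1, ENNReal.ofReal ((1 - θ) ^ (-(1 / 2 : ℝ))) = 2 := by
  rw [setLIntegral_Ioo_sub_rpow_neg_half_of_lt zero_lt_one, sub_zero, Real.sqrt_one, mul_one,
    ENNReal.ofReal_ofNat]

/-- **`L^∞` bound of the bilinear term** (Lemarié-Rieusset 2016, proof of Thm. 9.12, p. 263,
first display: the bilinear integral on the cone is bounded by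
`C'_γ √(Re τ - t₀) sup‖V‖_∞ sup‖W‖_∞`): with `C` the constant of the `L¹` kernel bound
`exists_lintegral_oseenKernelC_shift_le`, for fields `V, W` bounded by `K_V, K_W` on the domain
and `p ∈ schemeDomain ν T₀`,
`‖duhamelC ν V W p x‖ ≤ 3 C (√(νT₀)/ν) K_V K_W`
(`ν⁻¹ ∫₀¹ ‖m‖² C K_V K_W /(√(1-θ) Re m) dθ = 2C K_V K_W ‖m‖²/(ν Re m)`, `‖m‖ ≤ (3/2) Re m`,
`‖m‖ < √(νT₀)`). [cite: LemarieRieusset2016, Thm. 9.12 (proof, p. 263)] -/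
theorem exists_norm_duhamelC_le :
    ∃ C : ℝ, 0 < C ∧ ∀ {ν T₀ : ℝ}, 0 < ν →
      ∀ {V W : ℂ × EuclideanSpace ℂ ι → EuclideanSpace ℝ ι → EuclideanSpace ℂ ι} {KV KW : ℝ},
        0 ≤ KV → 0 ≤ KW →
        (∀ p ∈ schemeDomain ν T₀, ∀ y, ‖V p y‖ ≤ KV) → (∀ p ∈ schemeDomain ν T₀, ∀ y, ‖W p y‖ ≤ KW) →
        ∀ p ∈ schemeDomain ν T₀, ∀ x : EuclideanSpace ℝ ι,
          ‖duhamelC ν V W p x‖ ≤ 3 * C * (Real.sqrt (ν * T₀) / ν) * KV * KW := by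
  obtain ⟨C, hC, hK⟩ := exists_lintegral_oseenKernelC_shift_le (ι := ι)
  refine ⟨C, hC, fun {ν T₀} hν {V W KV KW} hKV hKW hVb hWb p hp x => ?_⟩
  obtain ⟨m, g⟩ := p
  have hre : 0 < m.re := hp.1
  obtain ⟨hm32, hmT⟩ := norm_rootTime_le hp
  set ρ : ℝ := m.re with hρ
  have hnn : 0 ≤ 3 * C * (Real.sqrt (ν * T₀) / ν) * KV * KW := by positivity
  rw [← ENNReal.ofReal_le_ofReal_iff hnn, ofReal_norm]
  unfold duhamelC
  -- the inner `L¹` bound, for `θ ∈ (0, 1)`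
  have hinner : ∀ θ ∈ Ioo (0 : ℝ) 1,
      ∫⁻ y, ‖oseenKernelC ((Real.sqrt (1 - θ) : ℂ) * m)
          (complexify y - (((1 - θ : ℝ) : ℂ) * m ^ 2) • g)
          (V ((Real.sqrt θ : ℂ) * m, g) (x - y)) (W ((Real.sqrt θ : ℂ) * m, g) (x - y))‖ₑ ≤
        ENNReal.ofReal (C * KV * KW / (Real.sqrt (1 - θ) * ρ)) := by
    intro θ hθ
    obtain ⟨hre', him'⟩ := sector_sqrt_one_sub_mul hp hθ.2
    have hc' := norm_kernelShift_le hp hθ.1.le hθ.2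
    have hp' := sqrt_mul_mem_schemeDomain hp hθ.1 hθ.2.le
    have h := hK hre' him' hc' (A := fun y => V ((Real.sqrt θ : ℂ) * m, g) (x + y))
      (B := fun y => W ((Real.sqrt θ : ℂ) * m, g) (x + y)) hKV hKW
      (fun y => hVb _ hp' _) (fun y => hWb _ hp' _) 0
    have hre_eq : (((Real.sqrt (1 - θ) : ℝ) : ℂ) * m).re = Real.sqrt (1 - θ) * ρ :=
      Complex.re_ofReal_mul _ _
    rw [hre_eq] at h
    calc _ = ∫⁻ y, ‖oseenKernelC ((Real.sqrt (1 - θ) : ℂ) * m)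
          (complexify (0 - (-y)) - (((1 - θ : ℝ) : ℂ) * m ^ 2) • g)
          (V ((Real.sqrt θ : ℂ) * m, g) (x + -y)) (W ((Real.sqrt θ : ℂ) * m, g) (x + -y))‖ₑ := by
          refine lintegral_congr fun y => ?_
          rw [zero_sub, neg_neg, ← sub_eq_add_neg]
      _ = ∫⁻ y, ‖oseenKernelC ((Real.sqrt (1 - θ) : ℂ) * m)
          (complexify (0 - y) - (((1 - θ : ℝ) : ℂ) * m ^ 2) • g)
          (V ((Real.sqrt θ : ℂ) * m, g) (x + y)) (W ((Real.sqrt θ : ℂ) * m, g) (x + y))‖ₑ :=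
          lintegral_neg_eq_self (fun y => ‖oseenKernelC ((Real.sqrt (1 - θ) : ℂ) * m)
            (complexify (0 - y) - (((1 - θ : ℝ) : ℂ) * m ^ 2) • g)
            (V ((Real.sqrt θ : ℂ) * m, g) (x + y)) (W ((Real.sqrt θ : ℂ) * m, g) (x + y))‖ₑ)
      _ ≤ _ := h
  -- the outer integral
  have hm0 : ‖((ν : ℂ))⁻¹‖ₑ = ENNReal.ofReal ν⁻¹ := by
    rw [← ofReal_norm, norm_inv, Complex.norm_real, Real.norm_of_nonneg hν.le]
  have hmeasθ : Measurable fun θ : ℝ => ENNReal.ofReal ((1 - θ) ^ (-(1 / 2 : ℝ))) :=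
    ((measurable_const.sub measurable_id).pow_const _).ennreal_ofReal
  calc ‖((ν : ℂ))⁻¹ • ∫ θ in Ioo (0 : ℝ) 1, (m ^ 2) • ∫ y,
          oseenKernelC ((Real.sqrt (1 - θ) : ℂ) * m) (complexify y - (((1 - θ : ℝ) : ℂ) * m ^ 2) • g)
            (V ((Real.sqrt θ : ℂ) * m, g) (x - y)) (W ((Real.sqrt θ : ℂ) * m, g) (x - y))‖ₑ
      ≤ ENNReal.ofReal ν⁻¹ * ∫⁻ θ in Ioo (0 : ℝ) 1, ‖(m ^ 2) • ∫ y,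
          oseenKernelC ((Real.sqrt (1 - θ) : ℂ) * m) (complexify y - (((1 - θ : ℝ) : ℂ) * m ^ 2) • g)
            (V ((Real.sqrt θ : ℂ) * m, g) (x - y)) (W ((Real.sqrt θ : ℂ) * m, g) (x - y))‖ₑ := by
        rw [enorm_smul, hm0]
        exact mul_le_mul' le_rfl (enorm_integral_le_lintegral_enorm _)
    _ ≤ ENNReal.ofReal ν⁻¹ * ∫⁻ θ in Ioo (0 : ℝ) 1,
          ENNReal.ofReal (‖m‖ ^ 2 * (C * KV * KW / ρ)) * ENNReal.ofReal ((1 - θ) ^ (-(1 / 2 : ℝ))) := by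
        refine mul_le_mul' le_rfl (setLIntegral_mono' measurableSet_Ioo fun θ hθ => ?_)
        have hs : 0 < Real.sqrt (1 - θ) := Real.sqrt_pos.2 (by linarith [hθ.2])
        rw [enorm_smul, ← ofReal_norm, norm_pow]
        refine (mul_le_mul' le_rfl ((enorm_integral_le_lintegral_enorm _).trans (hinner θ hθ))).trans ?_
        rw [← ENNReal.ofReal_mul (by positivity), ← ENNReal.ofReal_mul (by positivity)]
        refine ENNReal.ofReal_le_ofReal (le_of_eq ?_)
        rw [Real.rpow_neg (by linarith [hθ.2]), ← Real.sqrt_eq_rpow]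
        field_simp
    _ = ENNReal.ofReal ν⁻¹ * (ENNReal.ofReal (‖m‖ ^ 2 * (C * KV * KW / ρ)) * 2) := by
        rw [lintegral_const_mul _ hmeasθ, setLIntegral_Ioo_one_sub_rpow_neg_half]
    _ = ENNReal.ofReal (2 * C * KV * KW * (‖m‖ ^ 2 / (ν * ρ))) := by
        rw [← ENNReal.ofReal_ofNat, ← ENNReal.ofReal_mul (by positivity),
          ← ENNReal.ofReal_mul (by positivity)]
        congr 1; field_simp
    _ ≤ ENNReal.ofReal (3 * C * (Real.sqrt (ν * T₀) / ν) * KV * KW) := by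
        refine ENNReal.ofReal_le_ofReal ?_
        have h1 : ‖m‖ ^ 2 / (ν * ρ) ≤ 3 / 2 * Real.sqrt (ν * T₀) / ν := by
          rw [div_le_div_iff₀ (by positivity) hν]
          calc ‖m‖ ^ 2 * ν = ‖m‖ * ‖m‖ * ν := by ring
            _ ≤ (3 / 2 * ρ) * Real.sqrt (ν * T₀) * ν := by gcongr
            _ = 3 / 2 * Real.sqrt (ν * T₀) * (ν * ρ) := by ring
        calc 2 * C * KV * KW * (‖m‖ ^ 2 / (ν * ρ)) ≤ 2 * C * KV * KW * (3 / 2 * Real.sqrt (ν * T₀) / ν) := by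
              gcongr
          _ = 3 * C * (Real.sqrt (ν * T₀) / ν) * KV * KW := by ring

/-! ### Additivity of the complexified kernel in the tensor slots -/

/-- `oseenKernelC` is additive in the first tensor slot. [folklore] -/
theorem oseenKernelC_add_left (m : ℂ) (ζ a a' b : EuclideanSpace ℂ ι) :
    oseenKernelC m ζ (a + a') b = oseenKernelC m ζ a b + oseenKernelC m ζ a' b := by
  simp only [oseenKernelC, cdot_add_right, cdot_add_left]
  module

/-- `oseenKernelC` is additive in the second tensor slot. [folklore] -/
theorem oseenKernelC_add_right (m : ℂ) (ζ a b b' : EuclideanSpace ℂ ι) :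
    oseenKernelC m ζ a (b + b') = oseenKernelC m ζ a b + oseenKernelC m ζ a b' := by
  simp only [oseenKernelC, cdot_add_right]
  module

/-- `oseenKernelC` respects subtraction in the first tensor slot. [folklore] -/
theorem oseenKernelC_sub_left (m : ℂ) (ζ a a' b : EuclideanSpace ℂ ι) :
    oseenKernelC m ζ (a - a') b = oseenKernelC m ζ a b - oseenKernelC m ζ a' b := by
  rw [eq_sub_iff_add_eq, ← oseenKernelC_add_left, sub_add_cancel]

/-- `oseenKernelC` respects subtraction in the second tensor slot. [folklore] -/
theorem oseenKernelC_sub_right (m : ℂ) (ζ a b b' : EuclideanSpace ℂ ι) :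
    oseenKernelC m ζ a (b - b') = oseenKernelC m ζ a b - oseenKernelC m ζ a b' := by
  rw [eq_sub_iff_add_eq, ← oseenKernelC_add_right, sub_add_cancel]

/-- **The splitting of the quadratic increment at the level of the kernel**:
`𝒦[a, a] - 𝒦[b, b] = 𝒦[a - b, a] + 𝒦[b, a - b]`. [folklore] -/
theorem oseenKernelC_self_sub_self (m : ℂ) (ζ a b : EuclideanSpace ℂ ι) :
    oseenKernelC m ζ a a - oseenKernelC m ζ b b =
      oseenKernelC m ζ (a - b) a + oseenKernelC m ζ b (a - b) := by
  rw [oseenKernelC_sub_left, oseenKernelC_sub_right]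
  abel

end Literature.Analysis.FluidPDE

end
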